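import Mathlib
import Summits.NavierStokesRegularity.NavierStokesRegularity.Theorems.TaoLadderRungTwoFlatNonlinearHopForced
import HarnessLib

/-!
# Linear ⇒ nonlinear hop estimate for a forced deviation, TWO GAUGES: the forcing measured in the CONTRACTION gauge
  (junk race L8b-3 / kill point (K3) of HOP-INVARIANT-50 §4) (helper for the transfer theorem
  stmt-NavierStokesRegularity-23909 `GradedAdiabaticWake` and the λ₀ = 1 layer stmt-…-23908; route TaoLadderRungTwoFlat;
  cell harvest/h2-tao-ladder, p1 g21)

`…NonlinearHopForced` reads the forcing `f` of the deviation equation `η̇ = Q(W+η) − Q(W) + f` in the ADMISSIBLE gauge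
`w` (head gauge, `= 1` behind the pulse), so an interface input of absolute size `F` costs `F` in the conclusion.
theory-1 g38 (HOP-INVARIANT-50 §4 (K3)): the two-zone loop closes because the near → core entry is
`m₂₁ = O(e^{−cK} + ε₀)` — the interface sits `K` shells behind the core, where the CONTRACTION gauge
`ω = geomGauge g b` weighs `b^{−K}`. This file proves the sharper book-keeping: the a-priori bound and the quadratic
remainder still run in `w` (admissibility is needed for `Q(η)`), but the LINEAR response to the forcing is read in any
window-regular gauge `ω ≤ w`, so only `Fω = sup ω|f|` (`= b^{−K}·sup|f|` for the truncated deviation) enters: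

* `gauge_linearisation_error_forced₂` — `ω|η − u|(s) ≤ (‖α‖₁A·R² + Fω)·s·e^{2‖α‖₁MΛ' s}`, `R = (B̃ + FT)e^{2‖α‖₁MΛT}`;
* `nonlinear_hop_estimate_forced₂` — `ω_{i,k}|η_{i,k+N}(T) − c₁v₁ − c₂v₂| ≤ ρB + Γ(‖α‖₁A·R² + Fω)Te^{2‖α‖₁MΛ'T}` for a
  shift-regular `ω` (`ω_{i,k} ≤ Γω_{i,k+N}`).

HONEST FRAMING: elementary perturbation theory for MODEL lattices (Tao 2016 §4 vocabulary, shift-set parametrised); no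
pulse is constructed, nothing is certified, nothing here is a statement about the Navier–Stokes equations.
-/

noncomputable section

-- the sub-problem namespace repeats the summit name by design (D-0017)
set_option linter.dupNamespace false

namespace Summit.NavierStokesRegularity.NavierStokesRegularity.Theorems

open Set Filter Literature.Analysis.FluidPDE Literature.Analysis.FluidPDE.TaoCascade
open scoped Topology Nat

namespace QuadPolar

variable {m : ℕ}

/-- **GAUGE LINEARISATION ERROR, FORCED, TWO GAUGES.** As `gauge_linearisation_error_forced`, but the remainder is
read in a second window-regular gauge `ω ≤ w` (constant `Λ'`) in which the forcing is `Fω`-small: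
`ω_{i,n}|η_{i,n}(s) − u_{i,n}(s)| ≤ (‖α‖₁·A·R² + Fω)·s·e^{2‖α‖₁MΛ' s}`, `R = (B̃ + FT)e^{2‖α‖₁MΛT}` (the a-priori bound
still runs in the admissible gauge `w`). For the truncated deviation behind a captured pulse with `ω = geomGauge g b`
the interface forcing sits at depth `K` behind the core, so `Fω = b^{−K}·sup|f|` — theory-1's `m₂₁ = O(e^{−cK})`
(HOP-INVARIANT-50 §4 (K3)). [cite: Tao2016AveragedNS, §4 (4.8); folklore (Duhamel–Gronwall)] -/
theorem gauge_linearisation_error_forced₂ {𝕊 : Finset (ℤ × ℤ × ℤ)} (h𝕊 : IsNearestNeighbourSet 𝕊)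
    (α : Fin m → Fin m → Fin m → ℤ × ℤ × ℤ → ℝ) {w ω : Fin m → ℤ → ℝ} {Λ Λ' A : ℝ} (hw : IsWindowRegular w Λ)
    (hA : IsWindowAdmissible w A) (hω : IsWindowRegular ω Λ') (hωw : ∀ i k, ω i k ≤ w i k)
    {W η f u : Fin m → ℤ → ℝ → ℝ} {M Mu B F Fω T : ℝ}
    (hW : ∀ i n t, HasDerivAt (W i n) (quadTermOn 𝕊 0 α W i n t) t) (hηc : ∀ j k, Continuous (η j k))
    (hWb : ∀ j k t, |W j k t| ≤ M) (hXb : ∀ j k t, |(W + η) j k t| ≤ M)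
    (hfc : ∀ j k, Continuous (f j k)) (hfb : ∀ j k, ∀ t ∈ Icc 0 T, w j k * |f j k t| ≤ F) (hF : 0 ≤ F)
    (hfω : ∀ j k, ∀ t ∈ Icc 0 T, ω j k * |f j k t| ≤ Fω) (hFω : 0 ≤ Fω)
    (hη : ∀ i n t, HasDerivAt (η i n)
      (quadTermOn 𝕊 0 α (W + η) i n t - quadTermOn 𝕊 0 α W i n t + f i n t) t)
    (hu : ∀ i n t, HasDerivAt (u i n) (linTermOn 𝕊 0 α W u i n t) t)
    (hub : ∀ i n, ∀ t ∈ Icc 0 T, |u i n t| ≤ Mu) (hu0 : ∀ i n, u i n 0 = η i n 0)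
    (hB : ∀ i n, w i n * |η i n 0| ≤ B) (hT : 0 ≤ T) (i : Fin m) (n : ℤ) {s : ℝ} (hs : s ∈ Icc 0 T) :
    ω i n * |η i n s - u i n s| ≤
      (tableAbsSum 𝕊 α * A * ((B + F * T) * Real.exp (2 * tableAbsSum 𝕊 α * M * Λ * T)) ^ 2 + Fω) * s *
        Real.exp (2 * tableAbsSum 𝕊 α * M * Λ' * s) := by
  set ζ : Fin m → ℤ → ℝ → ℝ := fun j k t => η j k t - u j k t with hζ
  set g : Fin m → ℤ → ℝ → ℝ := fun j k t => quadTermOn 𝕊 0 α η j k t + f j k t with hg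
  set R : ℝ := (B + F * T) * Real.exp (2 * tableAbsSum 𝕊 α * M * Λ * T) with hR
  have hwpos := hw.1
  have hωpos := hω.1
  have hWc : ∀ j k, Continuous (W j k) := fun j k => continuous_iff_continuousAt.2 fun t => (hW j k t).continuousAt
  have hM : 0 ≤ M := (abs_nonneg _).trans (hWb i n 0)
  have hΛ : 0 ≤ Λ := le_trans zero_le_one hw.2.1
  have hB0 : 0 ≤ B := le_trans (mul_nonneg (hwpos i n).le (abs_nonneg _)) (hB i n)
  have hα := tableAbsSum_nonneg 𝕊 α
  have hR0 : 0 ≤ R := by rw [hR]; positivity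
  -- a priori gauge bound on η on [0, T] in the admissible gauge w
  have hηb : ∀ j k, ∀ t ∈ Icc 0 T, w j k * |η j k t| ≤ R := by
    intro j k t ht
    have h := gauge_forced_deviation_bound h𝕊 α hw hWc hηc hWb hXb hfc hfb hF hη hB j k ht
    have hmono : Real.exp (2 * tableAbsSum 𝕊 α * M * Λ * t) ≤ Real.exp (2 * tableAbsSum 𝕊 α * M * Λ * T) :=
      Real.exp_le_exp.mpr (mul_le_mul_of_nonneg_left ht.2 (by positivity))
    have h2 : B + F * t ≤ B + F * T := by nlinarith [ht.2]
    have h3 : 0 ≤ B + F * t := by nlinarith [ht.1]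
    calc w j k * |η j k t| ≤ (B + F * t) * Real.exp (2 * tableAbsSum 𝕊 α * M * Λ * t) := h
      _ ≤ (B + F * T) * Real.exp (2 * tableAbsSum 𝕊 α * M * Λ * T) :=
          mul_le_mul h2 hmono (Real.exp_pos _).le (h3.trans h2)
      _ = R := by rw [hR]
  -- the forcing g = Q(η) + f measured in ω: ω|Q(η)| ≤ w|Q(η)| ≤ ‖α‖₁ A R², ω|f| ≤ Fω
  have hgc : ∀ j k, Continuous (g j k) := fun j k => by
    have hq : Continuous fun t => quadTermOn 𝕊 0 α η j k t := by
      simp only [quadTermOn]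
      refine continuous_finsetSum _ fun i₁ _ => continuous_finsetSum _ fun i₂ _ =>
        continuous_finsetSum _ fun μ _ => ?_
      exact continuous_const.mul ((hηc _ _).mul (hηc _ _))
    exact hq.add (hfc j k)
  have hgb : ∀ j k, ∀ t ∈ Icc 0 T, ω j k * |g j k t| ≤ tableAbsSum 𝕊 α * A * R ^ 2 + Fω := fun j k t ht => by
    have h1 : w j k * |quadTermOn 𝕊 0 α η j k t| ≤ tableAbsSum 𝕊 α * A * R ^ 2 :=
      gauge_abs_quadTermOn_le h𝕊 α hwpos hA hR0 fun j' k' _ => hηb j' k' t ht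
    have h1' : ω j k * |quadTermOn 𝕊 0 α η j k t| ≤ tableAbsSum 𝕊 α * A * R ^ 2 :=
      (mul_le_mul_of_nonneg_right (hωw j k) (abs_nonneg _)).trans h1
    have h2 := hfω j k t ht
    have hω0 := (hωpos j k).le
    calc ω j k * |g j k t| ≤ ω j k * (|quadTermOn 𝕊 0 α η j k t| + |f j k t|) :=
          mul_le_mul_of_nonneg_left (abs_add_le _ _) hω0
      _ = ω j k * |quadTermOn 𝕊 0 α η j k t| + ω j k * |f j k t| := by ring
      _ ≤ tableAbsSum 𝕊 α * A * R ^ 2 + Fω := add_le_add h1' h2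
  have hG : 0 ≤ tableAbsSum 𝕊 α * A * R ^ 2 + Fω := by have := hA.1; positivity
  -- ζ solves the forced linearised equation along W with forcing g, zero data
  have hder : ∀ j k t, HasDerivAt (ζ j k) (linTermOn 𝕊 0 α W ζ j k t + g j k t) t := by
    intro j k t
    have e1 : quadTermOn 𝕊 0 α (W + η) j k t - quadTermOn 𝕊 0 α W j k t =
        linTermOn 𝕊 0 α W η j k t + quadTermOn 𝕊 0 α η j k t := by
      rw [quadTermOn_add_eq_lin]; ring
    have e2 : linTermOn 𝕊 0 α W ζ j k t = linTermOn 𝕊 0 α W η j k t - linTermOn 𝕊 0 α W u j k t := by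
      have hζe : ζ = η + (-1 : ℝ) • u := by funext a b c; simp [hζ]; ring
      rw [hζe, linTermOn_add, linTermOn_smul]; ring
    have hd : HasDerivAt (ζ j k)
        ((quadTermOn 𝕊 0 α (W + η) j k t - quadTermOn 𝕊 0 α W j k t + f j k t)
          - linTermOn 𝕊 0 α W u j k t) t := (hη j k t).sub (hu j k t)
    refine hd.congr_deriv ?_
    rw [e1, e2, hg]
    ring
  have hζb : ∀ j k, ∀ t ∈ Icc 0 T, |ζ j k t| ≤ 2 * M + Mu := fun j k t ht => by
    have h1 : |η j k t| ≤ 2 * M := by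
      have e : η j k t = (W + η) j k t - W j k t := by simp
      rw [e]
      linarith [abs_sub ((W + η) j k t) (W j k t), hXb j k t, hWb j k t]
    exact (abs_sub _ _).trans (add_le_add h1 (hub j k t ht))
  have hζ0 : ∀ j k, ω j k * |ζ j k 0| ≤ 0 := fun j k => by simp [hζ, hu0 j k]
  have h := gauge_abs_le_forced_exp h𝕊 α hω hWc hWb hgc hgb hG hder hζb hζ0 i n hs
  rw [zero_add] at h
  calc ω i n * |η i n s - u i n s| = ω i n * |ζ i n s| := rfl
    _ ≤ (tableAbsSum 𝕊 α * A * R ^ 2 + Fω) * s * Real.exp (2 * tableAbsSum 𝕊 α * M * Λ' * s) := h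

/-- **LINEAR ⇒ NONLINEAR HOP ESTIMATE, FORCED, TWO GAUGES.** As `nonlinear_hop_estimate_forced` with the read-out
gauge `ω` itself window-regular (`Λ'`), dominated sitewise by the admissible gauge `w`, and shift-regular
(`ω_{i,k} ≤ Γ·ω_{i,k+N}`); the forcing enters the conclusion only through its `ω`-size `Fω`:
`ω_{i,k}|η_{i,k+N}(T) − c₁v₁ − c₂v₂| ≤ ρB + Γ(‖α‖₁A·R² + Fω)Te^{2‖α‖₁MΛ'T}`, `R = (B̃ + FT)e^{2‖α‖₁MΛT}`.
[cite: Tao2016AveragedNS, §4 (4.8) and §6.3–6.4 (statement shape); route TaoLadderRungTwoFlat, transfer lemma L8b-3 / (K3)] -/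
theorem nonlinear_hop_estimate_forced₂ {𝕊 : Finset (ℤ × ℤ × ℤ)} (h𝕊 : IsNearestNeighbourSet 𝕊)
    (α : Fin m → Fin m → Fin m → ℤ × ℤ × ℤ → ℝ) {w ω : Fin m → ℤ → ℝ} {Λ Λ' A Γ : ℝ} (hw : IsWindowRegular w Λ)
    (hA : IsWindowAdmissible w A) (hω : IsWindowRegular ω Λ') (hωw : ∀ i k, ω i k ≤ w i k) {N : ℤ}
    (hΓ : ∀ i k, ω i k ≤ Γ * ω i (k + N))
    {W η f : Fin m → ℤ → ℝ → ℝ} {v₁ v₂ : Fin m → ℤ → ℝ} {M T ρ C B B' F Fω : ℝ} (hT : 0 ≤ T)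
    (hW : ∀ i n t, HasDerivAt (W i n) (quadTermOn 𝕊 0 α W i n t) t) (hηc : ∀ j k, Continuous (η j k))
    (hWb : ∀ i n t, |W i n t| ≤ M) (hXb : ∀ i n t, |(W + η) i n t| ≤ M)
    (hfc : ∀ j k, Continuous (f j k)) (hfb : ∀ j k, ∀ t ∈ Icc 0 T, w j k * |f j k t| ≤ F) (hF : 0 ≤ F)
    (hfω : ∀ j k, ∀ t ∈ Icc 0 T, ω j k * |f j k t| ≤ Fω) (hFω : 0 ≤ Fω)
    (hη : ∀ i n t, HasDerivAt (η i n)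
      (quadTermOn 𝕊 0 α (W + η) i n t - quadTermOn 𝕊 0 α W i n t + f i n t) t)
    (hlin : ∀ u : Fin m → ℤ → ℝ → ℝ, (∀ i n t, HasDerivAt (u i n) (linTermOn 𝕊 0 α W u i n t) t) →
      (∃ Mu : ℝ, ∀ i n, ∀ t ∈ Icc 0 T, |u i n t| ≤ Mu) → (∀ i k, ω i k * |u i k 0| ≤ B) →
        ∃ c₁ c₂ : ℝ, |c₁| ≤ C * B ∧ |c₂| ≤ C * B ∧
          ∀ i k, ω i k * |u i (k + N) T - c₁ * v₁ i k - c₂ * v₂ i k| ≤ ρ * B)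
    (hB : ∀ i k, ω i k * |η i k 0| ≤ B) (hB' : ∀ i k, w i k * |η i k 0| ≤ B') :
    ∃ c₁ c₂ : ℝ, |c₁| ≤ C * B ∧ |c₂| ≤ C * B ∧
      ∀ i k, ω i k * |η i (k + N) T - c₁ * v₁ i k - c₂ * v₂ i k| ≤
        ρ * B + Γ * ((tableAbsSum 𝕊 α * A * ((B' + F * T) * Real.exp (2 * tableAbsSum 𝕊 α * M * Λ * T)) ^ 2
          + Fω) * T * Real.exp (2 * tableAbsSum 𝕊 α * M * Λ' * T)) := by
  have hM0 : 0 ≤ max M 0 := le_max_right _ _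
  have hWb' : ∀ j k t, |W j k t| ≤ max M 0 := fun j k t => (hWb j k t).trans (le_max_left _ _)
  have hlipW : ∀ j k t s, |W j k t - W j k s| ≤ tableAbsSum 𝕊 α * (max M 0) ^ 2 * |t - s| :=
    lipschitz_time_of_globalSol 𝕊 α hW hWb'
  have hΛt : 0 ≤ tableAbsSum 𝕊 α * (max M 0) ^ 2 := by have := tableAbsSum_nonneg 𝕊 α; positivity
  have hd0 : ∀ i k, |(fun i k => η i k 0) i k| ≤ 2 * max M 0 := by
    intro i k
    have h1 := hXb i k 0
    have h2 := hWb i k 0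
    have h3 := le_max_left M 0
    have e : η i k 0 = (W + η) i k 0 - W i k 0 := by simp
    show |η i k 0| ≤ 2 * max M 0
    rw [e]
    calc |(W + η) i k 0 - W i k 0| ≤ |(W + η) i k 0| + |W i k 0| := abs_sub _ _
      _ ≤ 2 * max M 0 := by linarith
  obtain ⟨u, hu0, hud, hub⟩ := exists_linearised_solution 𝕊 α hWb' hM0 hΛt hlipW hd0
  have hubT : ∀ i n, ∀ t ∈ Icc 0 T,
      |u i n t| ≤ 2 * max M 0 * Real.exp (2 * tableAbsSum 𝕊 α * max M 0 * T) :=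
    fun i n t ht => hub T hT i n t ⟨by linarith [ht.1], ht.2⟩
  obtain ⟨c₁, c₂, hc₁, hc₂, hlinu⟩ := hlin u hud ⟨_, hubT⟩ (fun i k => by rw [hu0]; exact hB i k)
  refine ⟨c₁, c₂, hc₁, hc₂, fun i k => ?_⟩
  have hu0' : ∀ i n, u i n 0 = η i n 0 := fun i n => hu0 i n
  have herr := gauge_linearisation_error_forced₂ h𝕊 α hw hA hω hωw hW hηc hWb hXb hfc hfb hF hfω hFω hη hud
    hubT hu0' hB' hT i (k + N) ⟨hT, le_rfl⟩
  have hωpos : 0 < ω i (k + N) := hω.1 i (k + N)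
  have hΓ0 : 0 ≤ Γ := by
    have h := (hω.1 i k).le.trans (hΓ i k)
    by_contra hneg
    push Not at hneg
    have : Γ * ω i (k + N) < 0 := mul_neg_of_neg_of_pos hneg hωpos
    linarith
  have htri : |η i (k + N) T - c₁ * v₁ i k - c₂ * v₂ i k| ≤
      |u i (k + N) T - c₁ * v₁ i k - c₂ * v₂ i k| + |η i (k + N) T - u i (k + N) T| := by
    have e : η i (k + N) T - c₁ * v₁ i k - c₂ * v₂ i k =
        (u i (k + N) T - c₁ * v₁ i k - c₂ * v₂ i k) + (η i (k + N) T - u i (k + N) T) := by ring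
    rw [e]; exact abs_add_le _ _
  have h2 : ω i k * |η i (k + N) T - u i (k + N) T| ≤
      Γ * ((tableAbsSum 𝕊 α * A * ((B' + F * T) * Real.exp (2 * tableAbsSum 𝕊 α * M * Λ * T)) ^ 2 + Fω)
        * T * Real.exp (2 * tableAbsSum 𝕊 α * M * Λ' * T)) := by
    calc ω i k * |η i (k + N) T - u i (k + N) T|
        ≤ Γ * ω i (k + N) * |η i (k + N) T - u i (k + N) T| :=
          mul_le_mul_of_nonneg_right (hΓ i k) (abs_nonneg _)
      _ = Γ * (ω i (k + N) * |η i (k + N) T - u i (k + N) T|) := by ring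
      _ ≤ _ := mul_le_mul_of_nonneg_left herr hΓ0
  calc ω i k * |η i (k + N) T - c₁ * v₁ i k - c₂ * v₂ i k|
      ≤ ω i k * (|u i (k + N) T - c₁ * v₁ i k - c₂ * v₂ i k| + |η i (k + N) T - u i (k + N) T|) :=
        mul_le_mul_of_nonneg_left htri (hω.1 i k).le
    _ = ω i k * |u i (k + N) T - c₁ * v₁ i k - c₂ * v₂ i k| + ω i k * |η i (k + N) T - u i (k + N) T| := by
        ring
    _ ≤ _ := add_le_add (hlinu i k) h2

end QuadPolar

end Summit.NavierStokesRegularity.NavierStokesRegularity.Theorems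

end
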